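import Mathlib

/-!
# Torsion versus nilradical in a local ring (algebraic core of PROPOSITION T, s41)

In the solo-informed cell programme (FINDING_R9 §8) the flat level-one pseudodeformation
ring `R = R_F^𝒞` at a cyclic cell is shown to be module-finite over `ℤ₇` (THEOREM F).  The
structure statement "`R` is a nilpotent thickening of the Hecke algebra by its finite
`7`-power torsion ideal" rests on two elementary facts about a LOCAL commutative ring `R`
and an element `x` (there `x = 7`):

* if every prime ideal containing `x` is maximal (true when `R/(x)` is Artinian, e.g. `R`
  module-finite over `ℤ_p` and `x = p`) and `x` is not nilpotent, then every `x`-power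
  torsion element is nilpotent (`isNilpotent_of_pow_mul_eq_zero`);
* if `R[1/x]` is reduced, then every nilpotent element is `x`-power torsion
  (`exists_pow_mul_eq_zero_of_isNilpotent`);
* `isMaximal_of_isPrime_of_mem_of_isArtinianRing` supplies the first hypothesis from
  "`R ⧸ (x)` is Artinian", and `isNilpotent_iff_torsion_of_isArtinianRing_quotient` packages
  the equivalence "nilpotent ↔ `x`-power torsion".

No number theory is formalised here.
-/

namespace Summit.Langlands.Langlands.Theorems

open IsLocalRing

variable {R : Type*} [CommRing R]

/-- In a local ring in which every prime ideal containing `x` is maximal and `x` is not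
nilpotent, `x` lies in no minimal prime. -/
theorem not_mem_of_mem_minimalPrimes [IsLocalRing R] {x : R}
    (hmax : ∀ P : Ideal R, P.IsPrime → x ∈ P → P.IsMaximal) (hx : ¬ IsNilpotent x)
    {q : Ideal R} (hq : q ∈ (⊥ : Ideal R).minimalPrimes) : x ∉ q := by
  intro hxq
  have hqprime : q.IsPrime := hq.1.1
  have hqmax : q.IsMaximal := hmax q hqprime hxq
  have hqm : q = maximalIdeal R := IsLocalRing.eq_maximalIdeal hqmax
  apply hx
  rw [nilpotent_iff_mem_prime]
  intro P hP
  have hPle : P ≤ q := hqm ▸ IsLocalRing.le_maximalIdeal hP.ne_top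
  have hqle : q ≤ P := hq.2 ⟨hP, bot_le⟩ hPle
  exact hqle hxq

/-- Torsion is nilpotent: in a local ring in which every prime ideal containing `x` is
maximal and `x` is not nilpotent, `x ^ n * r = 0` forces `r` to be nilpotent. -/
theorem isNilpotent_of_pow_mul_eq_zero [IsLocalRing R] {x : R}
    (hmax : ∀ P : Ideal R, P.IsPrime → x ∈ P → P.IsMaximal) (hx : ¬ IsNilpotent x)
    {r : R} {n : ℕ} (h : x ^ n * r = 0) : IsNilpotent r := by
  rw [← mem_nilradical, nilradical, ← Ideal.sInf_minimalPrimes, Submodule.mem_sInf]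
  intro q hq
  have hqprime : Ideal.IsPrime q := hq.1.1
  have hxq : x ∉ q := not_mem_of_mem_minimalPrimes hmax hx hq
  have hmem : x ^ n * r ∈ q := by rw [h]; exact q.zero_mem
  rcases hqprime.mem_or_mem hmem with hxn | hr
  · exact absurd (hqprime.mem_of_pow_mem n hxn) hxq
  · exact hr

/-- Nilpotent is torsion: if the localisation `R[1/x]` is reduced, every nilpotent element
of `R` is killed by a power of `x`. -/
theorem exists_pow_mul_eq_zero_of_isNilpotent {x : R}
    [IsReduced (Localization.Away x)] {r : R} (hr : IsNilpotent r) :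
    ∃ n : ℕ, x ^ n * r = 0 := by
  have h0 : algebraMap R (Localization.Away x) r = 0 :=
    (hr.map (algebraMap R (Localization.Away x))).eq_zero
  rw [IsLocalization.map_eq_zero_iff (Submonoid.powers x)] at h0
  obtain ⟨⟨m, ⟨n, rfl⟩⟩, hm⟩ := h0
  exact ⟨n, hm⟩

/-- PROPOSITION T, algebraic core: under both hypotheses the `x`-power torsion elements are
exactly the nilpotent elements. -/
theorem isNilpotent_iff_exists_pow_mul_eq_zero [IsLocalRing R] {x : R}
    (hmax : ∀ P : Ideal R, P.IsPrime → x ∈ P → P.IsMaximal) (hx : ¬ IsNilpotent x)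
    [IsReduced (Localization.Away x)] (r : R) :
    IsNilpotent r ↔ ∃ n : ℕ, x ^ n * r = 0 :=
  ⟨exists_pow_mul_eq_zero_of_isNilpotent, fun ⟨_, h⟩ => isNilpotent_of_pow_mul_eq_zero hmax hx h⟩

/-- If `R ⧸ (x)` is Artinian (e.g. `R` module-finite over `ℤ_p` and `x = p`) then every prime
ideal containing `x` is maximal — the first hypothesis of `isNilpotent_of_pow_mul_eq_zero`. -/
theorem isMaximal_of_isPrime_of_mem_of_isArtinianRing {x : R}
    [IsArtinianRing (R ⧸ Ideal.span ({x} : Set R))] (P : Ideal R) (hP : P.IsPrime)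
    (hx : x ∈ P) : P.IsMaximal := by
  set I : Ideal R := Ideal.span ({x} : Set R) with hI
  have hIP : I ≤ P := by
    rw [hI, Ideal.span_le]; simpa using hx
  have hker : RingHom.ker (Ideal.Quotient.mk I) ≤ P := by
    rw [Ideal.mk_ker]; exact hIP
  have hsurj : Function.Surjective (Ideal.Quotient.mk I) := Ideal.Quotient.mk_surjective
  haveI : (P.map (Ideal.Quotient.mk I)).IsPrime := Ideal.map_isPrime_of_surjective hsurj hker
  have hmax : (P.map (Ideal.Quotient.mk I)).IsMaximal :=
    IsArtinianRing.isMaximal_of_isPrime _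
  have hcomap : (P.map (Ideal.Quotient.mk I)).comap (Ideal.Quotient.mk I) = P := by
    rw [Ideal.comap_map_of_surjective _ hsurj, sup_eq_left]
    rw [← RingHom.ker_eq_comap_bot]; exact hker
  rw [← hcomap]
  exact Ideal.comap_isMaximal_of_surjective _ hsurj

/-- PROPOSITION T, algebraic core, packaged: in a local ring `R` with `R ⧸ (x)` Artinian,
`x` not nilpotent and `R[1/x]` reduced, an element is nilpotent iff it is `x`-power torsion.
(Applied with `R = R_F^𝒞`, `x = 7`: the nilradical is the `7`-power torsion ideal.) -/
theorem isNilpotent_iff_torsion_of_isArtinianRing_quotient [IsLocalRing R] {x : R}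
    [IsArtinianRing (R ⧸ Ideal.span ({x} : Set R))] (hx : ¬ IsNilpotent x)
    [IsReduced (Localization.Away x)] (r : R) :
    IsNilpotent r ↔ ∃ n : ℕ, x ^ n * r = 0 :=
  isNilpotent_iff_exists_pow_mul_eq_zero
    (fun P hP hxP => isMaximal_of_isPrime_of_mem_of_isArtinianRing P hP hxP) hx r

end Summit.Langlands.Langlands.Theorems
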